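import Literature.Analysis.FluidPDE.AxisymSwirlCutoffEnergy
import Literature.Analysis.FluidPDE.ClassicalL2Stability
import HarnessLib

/-!
# `‖Γ(t)‖_{L²} ≤ ‖Γ₀‖_{L²}` for axisymmetric Navier–Stokes flows in Tao's class
# (Lei–Zhang 2017, §4, p. 10)

Analysis/FluidPDE proof file (theorems only; no definitions, no named facts) on the discharge path
of the named fact `Literature.Analysis.FluidPDE.LeiZhang2017_smallSwirl_regularity`
(Lei–Zhang 2017, Thm. 1.4), sequel of `AxisymSwirlCutoffEnergy.lean`.

Lei–Zhang (arXiv:1505.02628, §4, p. 10): "Recall that we have the following a priori estimate: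
`‖Γ‖_{L²} ≤ ‖Γ₀‖_{L²}`, `‖Γ‖_{L^∞} ≤ ‖Γ₀‖_{L^∞}`."

* `IsTaoSolutionOn.lintegral_swirl_sq_le` — for a Tao-class solution on `[0, T]` (`ν > 0`) with
  axisymmetric slices whose datum has `Γ₀ = swirl u₀ ∈ L² ∩ L^∞`, for every `t ∈ [0, T]`,
  `∫ Γ(t)² ≤ ∫ Γ₀²` (stated with the lower Lebesgue integral, so that `Γ(t) ∈ L²` is part of the
  conclusion).

Proof: integrate the localised inequality `IsClassicalNSSolutionOn.integral_sqBallCutoff_mul_swirl_le`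
in time (`IsSmoothSpaceTimeOn.integral_Ioo_integral_mul_timeDerivWithin_mul` for the jointly smooth
swirl family and the compactly supported weight `χ_R`, `∂ₜΓ = swirl (∂ₜu)`):
`½ ∫ χ_R Γ(t)² ≤ ½ ∫ χ_R Γ₀² + K ∫₀ᵀ ∫ (1 − χ_{R/2}) |u|²`, with `K = 8MD + 192νD² + 32νD`
(`|u| ≤ B`, `‖Du‖ ≤ B'`, `|Γ| ≤ M` on the slab, Tao's class and the maximum principle
`IsTaoSolutionOn.abs_swirl_le`).  As `R = 2(n+1) → ∞` the space–time tail tends to `0` (dominated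
convergence in `x` at each time, then in `t` on `(0, T)`, the energy being bounded and
`t ↦ ‖u(t)‖²_{L²}` continuous, `IsSmoothSpaceTimeOn.l2_balance`), and Fatou's lemma gives the claim.

## Mathlib / tree search

Tree: `IsClassicalNSSolutionOn.integral_sqBallCutoff_mul_swirl_le` (`AxisymSwirlCutoffEnergy`),
`IsSmoothSpaceTimeOn.integral_Ioo_integral_mul_timeDerivWithin_mul`,
`continuousOn_integral_mul_of_continuousOn` (`EnergyToolkit`), `IsSmoothSpaceTimeOn.l2_balance`
(`ClassicalL2Stability`), `IsTaoSolutionOn.abs_swirl_le` (`SwirlMaximumPrinciple`),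
`IsTaoSolutionOn.exists_bound_velocity`, `HasBoundedSobolevNormsOn.exists_forall_norm_iteratedFDeriv_le`
(`TaoClassGlue`, `AxisymQuotientRayAverage`), `eventually_sqBallCutoff_eq_one`,
`hasCompactSupport_sqBallCutoff`, `contDiff_sqBallCutoff` (`AxisymWeights`),
`Calculus.exists_bound_deriv_smoothTransition`.  Mathlib: `tendsto_integral_of_dominated_convergence`,
`lintegral_liminf_le'`, `ofReal_integral_eq_lintegral_ofReal`.

## References

* Z. Lei, Q. S. Zhang, Pacific J. Math. 289 (2017) 169–187, arXiv:1505.02628, §4 p. 10.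
  [`LeiZhang2017`]
* D. Chae, J. Lee, Math. Z. 239 (2002), 645–671, §3. [folklore]
-/

noncomputable section

open MeasureTheory Set Function Filter Topology InnerProductSpace WithLp
open scoped RealInnerProductSpace ContDiff ENNReal NNReal

namespace Literature.Analysis.FluidPDE

namespace IsTaoSolutionOn

variable {T ν : ℝ} {u₀ : EuclideanSpace ℝ (Fin 3) → EuclideanSpace ℝ (Fin 3)}
  {u : ℝ → EuclideanSpace ℝ (Fin 3) → EuclideanSpace ℝ (Fin 3)} {p : ℝ → EuclideanSpace ℝ (Fin 3) → ℝ}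

/-- The swirl family of a jointly smooth field is jointly smooth (inner product with the smooth
field `J x`). [folklore] -/
theorem isSmoothSpaceTimeOn_swirl {S : Set ℝ} (h : IsSmoothSpaceTimeOn S u) :
    IsSmoothSpaceTimeOn S fun t => swirl (u t) := by
  have h1 : (fun t => swirl (u t)) = fun t x => ⟪rotGenL x, u t x⟫ := by
    funext t x
    rw [swirl_eq_inner_rotGen, rotGenL_apply]
  rw [h1]
  exact (isSmoothSpaceTimeOn_const_time rotGenL.contDiff S).inner h

/-- In Tao's class the velocity gradient is bounded on the slab. [folklore] -/
theorem exists_bound_fderiv (h : IsTaoSolutionOn T ν u₀ u p) :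
    ∃ B' : ℝ, 0 ≤ B' ∧ ∀ t ∈ Icc 0 T, ∀ x, ‖fderiv ℝ (u t) x‖ ≤ B' := by
  obtain ⟨B', hB'0, hB'⟩ := h.sobolev.exists_forall_norm_iteratedFDeriv_le
    (fun t ht => h.classical.contDiff_velocity ht) 1
  refine ⟨B', hB'0, fun t ht x => ?_⟩
  have := hB' t ht x
  rwa [← norm_iteratedFDeriv_fderiv (n := 0), norm_iteratedFDeriv_zero] at this

/-- In Tao's class the energy is bounded on the slab (real form). [folklore] -/
theorem exists_bound_integral_norm_sq (h : IsTaoSolutionOn T ν u₀ u p) :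
    ∃ E : ℝ, 0 ≤ E ∧ ∀ t ∈ Icc 0 T, ∫ x, ‖u t x‖ ^ 2 ≤ E := by
  obtain ⟨C, hC⟩ := h.sobolev 0
  refine ⟨C, C.coe_nonneg, fun t ht => ?_⟩
  have hC' : ∫⁻ x, ‖u t x‖ₑ ^ 2 ≤ C := by
    refine le_of_eq_of_le (lintegral_congr fun x => ?_) (hC t ht)
    rw [← ofReal_norm, ← ofReal_norm, norm_iteratedFDeriv_zero]
  have hnn : 0 ≤ᵐ[volume] fun x => ‖u t x‖ ^ 2 := ae_of_all _ fun x => by positivity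
  rw [integral_eq_lintegral_of_nonneg_ae hnn
    ((h.classical.contDiff_velocity ht).continuous.norm.pow 2).aestronglyMeasurable]
  have heq : ∫⁻ x, ENNReal.ofReal (‖u t x‖ ^ 2) = ∫⁻ x, ‖u t x‖ₑ ^ 2 :=
    lintegral_congr fun x => by rw [← ofReal_norm, ENNReal.ofReal_pow (norm_nonneg _)]
  rw [heq]
  calc (∫⁻ x, ‖u t x‖ₑ ^ 2).toReal ≤ (C : ℝ≥0∞).toReal := ENNReal.toReal_mono ENNReal.coe_ne_top hC'
    _ = C := ENNReal.coe_toReal C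

/-- **`‖Γ(t)‖_{L²} ≤ ‖Γ₀‖_{L²}` in Tao's class** (Lei–Zhang 2017, §4, p. 10: "we have the following
a priori estimate `‖Γ‖_{L²} ≤ ‖Γ₀‖_{L²}`"): for a Tao-class solution `(u, p)` on `[0, T]` (`ν > 0`,
`T > 0`) from `u₀` with axisymmetric slices, `|Γ₀| ≤ M` and `Γ₀ ∈ L²` (`Γ₀ = swirl u₀ = r u₀^θ`),
for every `t ∈ [0, T]`: `∫ Γ(t)² ≤ ∫ Γ₀²` (lower Lebesgue integrals; in particular `Γ(t) ∈ L²`).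
[cite: LeiZhang2017, §4 (p. 10), "‖Γ‖_{L²} ≤ ‖Γ₀‖_{L²}"] -/
theorem lintegral_swirl_sq_le (h : IsTaoSolutionOn T ν u₀ u p) (hν : 0 < ν) (hT : 0 < T)
    (hax : ∀ t ∈ Icc 0 T, IsAxisymmetric (u t)) {M : ℝ} (hM : ∀ x, |swirl u₀ x| ≤ M)
    (hΓ0 : ∫⁻ x, ‖swirl u₀ x‖ₑ ^ 2 < ⊤) {t : ℝ} (ht : t ∈ Icc 0 T) :
    ∫⁻ x, ‖swirl (u t) x‖ₑ ^ 2 ≤ ∫⁻ x, ‖swirl u₀ x‖ₑ ^ 2 := by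
  have hcl := h.classical
  have hsm : IsSmoothSpaceTimeOn (Icc 0 T) u := hcl.smooth_velocity
  have hU : UniqueDiffOn ℝ (Icc 0 T) := uniqueDiffOn_Icc hT
  obtain ⟨B, -, hB⟩ := h.exists_bound_velocity
  obtain ⟨B', -, hB'⟩ := h.exists_bound_fderiv
  obtain ⟨E, hE0, hE⟩ := h.exists_bound_integral_norm_sq
  obtain ⟨D, hD0, hD⟩ := Calculus.exists_bound_deriv_smoothTransition
  have hMt : ∀ s ∈ Icc 0 T, ∀ x, |swirl (u s) x| ≤ M := h.abs_swirl_le hν hT hax hM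
  have hM0 : 0 ≤ M := (abs_nonneg _).trans (hM 0)
  set K : ℝ := 8 * M * D + 192 * ν * D ^ 2 + 32 * ν * D with hK
  have hK0 : 0 ≤ K := by have := hν.le; positivity
  -- the swirl family and its time derivative
  have hw : IsSmoothSpaceTimeOn (Icc 0 T) fun s => swirl (u s) := isSmoothSpaceTimeOn_swirl hsm
  have hw' : ∀ s ∈ Icc 0 T, ∀ x, FluidPDE.timeDerivWithin (Icc 0 T) (fun s => swirl (u s)) s x =
      swirl (FluidPDE.timeDerivWithin (Icc 0 T) u s) x := fun s hs x => hsm.timeDerivWithin_swirl_eq_swirl hs x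
  -- the cut-offs: `φ n = χ_{2(n+1)}`, `χ n = χ_{n+1}`
  set Rn : ℕ → ℝ := fun n => 2 * ((n : ℝ) + 1) with hRn
  have hRpos : ∀ n, 0 < Rn n := fun n => by simp only [hRn]; positivity
  have hR2 : ∀ n, Rn n / 2 = (n : ℝ) + 1 := fun n => by simp only [hRn]; ring
  set φ : ℕ → EuclideanSpace ℝ (Fin 3) → ℝ := fun n y => Real.smoothTransition (2 - ‖y‖ ^ 2 / (Rn n) ^ 2) ^ 2
    with hφ_def
  set χ : ℕ → EuclideanSpace ℝ (Fin 3) → ℝ := fun n y => Real.smoothTransition (2 - ‖y‖ ^ 2 / ((n : ℝ) + 1) ^ 2) ^ 2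
    with hχ_def
  have cφ : ∀ n, Continuous (φ n) := fun n => (contDiff_sqBallCutoff (Rn n) (n := 0)).continuous
  have sφ : ∀ n, HasCompactSupport (φ n) := fun n => hasCompactSupport_sqBallCutoff (hRpos n)
  have cχ : ∀ n, Continuous (χ n) := fun n => (contDiff_sqBallCutoff ((n : ℝ) + 1) (n := 0)).continuous
  have sχ : ∀ n, HasCompactSupport (χ n) := fun n => hasCompactSupport_sqBallCutoff (by positivity)
  have hφ0 : ∀ n x, 0 ≤ φ n x := fun n x => sq_nonneg _
  have hφ1 : ∀ n x, φ n x ≤ 1 := fun n x => sqBallCutoff_le_one _ _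
  have hχ0 : ∀ n x, 0 ≤ χ n x := fun n x => sq_nonneg _
  have hχ1 : ∀ n x, χ n x ≤ 1 := fun n x => sqBallCutoff_le_one _ _
  have hχev : ∀ x, ∀ᶠ n : ℕ in atTop, χ n x = 1 := fun x => eventually_sqBallCutoff_eq_one x
  have hφev : ∀ x, ∀ᶠ n : ℕ in atTop, φ n x = 1 := by
    intro x
    obtain ⟨N, hN⟩ := exists_nat_gt ‖x‖
    refine eventually_atTop.2 ⟨N, fun n hn => sqBallCutoff_eq_one (hRpos n) ?_⟩
    have : (N : ℝ) ≤ n := by exact_mod_cast hn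
    simp only [hRn]; linarith
  ------------------------------------------------------------------
  -- Step 1: the localised inequality at each time
  ------------------------------------------------------------------
  have hL2s : ∀ s ∈ Icc 0 T, MemLp (u s) 2 volume := fun s hs => h.continuousL2.1 s hs
  have hloc : ∀ n, ∀ s ∈ Icc 0 T,
      ∫ x, φ n x * (swirl (FluidPDE.timeDerivWithin (Icc 0 T) u s) x * swirl (u s) x) ≤
        K * ∫ x, (1 - χ n x) * ‖u s x‖ ^ 2 := by
    intro n s hs
    have hh := hcl.integral_sqBallCutoff_mul_swirl_le hU hax hν.le hs (hL2s s hs) (hB s hs) (hB' s hs)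
      (hMt s hs) hD (hRpos n)
    simp only [hR2] at hh
    exact hh
  ------------------------------------------------------------------
  -- Step 2: the tail functional, continuity in time
  ------------------------------------------------------------------
  have iu2 : ∀ s ∈ Icc 0 T, Integrable (fun x => ‖u s x‖ ^ 2) volume := fun s hs =>
    (memLp_two_iff_integrable_sq_norm (hL2s s hs).1).1 (hL2s s hs)
  have iχu : ∀ n, ∀ s ∈ Icc 0 T, Integrable (fun x => χ n x * ‖u s x‖ ^ 2) volume := fun n s hs =>
    (iu2 s hs).bdd_mul (c := 1) (cχ n).aestronglyMeasurable (ae_of_all _ fun x => by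
      rw [Real.norm_eq_abs, abs_of_nonneg (hχ0 n x)]; exact hχ1 n x)
  have iτu : ∀ n, ∀ s ∈ Icc 0 T, Integrable (fun x => (1 - χ n x) * ‖u s x‖ ^ 2) volume := fun n s hs =>
    (iu2 s hs).bdd_mul (c := 1) (continuous_const.sub (cχ n)).aestronglyMeasurable (ae_of_all _ fun x => by
      rw [Real.norm_eq_abs, abs_le]; constructor <;> linarith [hχ0 n x, hχ1 n x])
  set tail : ℕ → ℝ → ℝ := fun n s => ∫ x, (1 - χ n x) * ‖u s x‖ ^ 2 with htail
  have htail_eq : ∀ n, ∀ s ∈ Icc 0 T, tail n s = (∫ x, ‖u s x‖ ^ 2) - ∫ x, χ n x * ‖u s x‖ ^ 2 := by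
    intro n s hs
    simp only [htail]
    rw [← integral_sub (iu2 s hs) (iχu n s hs)]
    exact integral_congr_ae (ae_of_all _ fun x => by ring)
  have htail0 : ∀ n s, 0 ≤ tail n s := fun n s =>
    integral_nonneg fun x => mul_nonneg (by linarith [hχ1 n x]) (sq_nonneg _)
  have htailE : ∀ n, ∀ s ∈ Icc 0 T, tail n s ≤ E := fun n s hs =>
    (integral_mono (iτu n s hs) (iu2 s hs) fun x => by
      have := hχ0 n x; nlinarith [sq_nonneg ‖u s x‖]).trans (hE s hs)
  -- continuity in time of `s ↦ ∫ |u s|²` (`l2_balance`) and of `s ↦ ∫ χ |u s|²`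
  obtain ⟨C₀, hC₀⟩ := h.sobolev 0
  obtain ⟨C₁, hC₁⟩ := h.sobolev_dt 0
  have hC₀' : ∀ s ∈ Icc 0 T, ∫⁻ x, ‖u s x‖ₑ ^ 2 ≤ C₀ := fun s hs =>
    le_of_eq_of_le (lintegral_congr fun x => by
      rw [← ofReal_norm, ← ofReal_norm, norm_iteratedFDeriv_zero]) (hC₀ s hs)
  have hC₁' : ∀ s ∈ Icc 0 T, ∫⁻ x, ‖FluidPDE.timeDerivWithin (Icc 0 T) u s x‖ₑ ^ 2 ≤ C₁ := fun s hs =>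
    le_of_eq_of_le (lintegral_congr fun x => by
      rw [← ofReal_norm, ← ofReal_norm, norm_iteratedFDeriv_zero]) (hC₁ s hs)
  have cE : ContinuousOn (fun s => ∫ x, ‖u s x‖ ^ 2) (Icc 0 T) := (hsm.l2_balance hT hC₀' hC₁').2.1
  have cu2 : ContinuousOn (fun z : ℝ × EuclideanSpace ℝ (Fin 3) => ‖u z.1 z.2‖ ^ 2) (Icc 0 T ×ˢ univ) :=
    (hsm.continuousOn.norm).pow 2
  have cχu : ∀ n, ContinuousOn (fun s => ∫ x, χ n x * ‖u s x‖ ^ 2) (Icc 0 T) := fun n =>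
    continuousOn_integral_mul_of_continuousOn (G := fun z => ‖u z.1 z.2‖ ^ 2) (cχ n) (sχ n) cu2
  have ctail : ∀ n, ContinuousOn (tail n) (Icc 0 T) := fun n =>
    (cE.sub (cχu n)).congr fun s hs => htail_eq n s hs
  have itail : ∀ n, IntegrableOn (tail n) (Ioo 0 T) volume := fun n =>
    ((ctail n).integrableOn_compact isCompact_Icc).mono_set Ioo_subset_Icc_self
  ------------------------------------------------------------------
  -- Step 3: time integration of the localised inequality
  ------------------------------------------------------------------
  have hjoint : ContinuousOn (fun z : ℝ × EuclideanSpace ℝ (Fin 3) =>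
      swirl (FluidPDE.timeDerivWithin (Icc 0 T) u z.1) z.2 * swirl (u z.1) z.2) (Icc 0 T ×ˢ univ) := by
    have c1 : ContinuousOn (uncurry fun s x => swirl (FluidPDE.timeDerivWithin (Icc 0 T) u s) x)
        (Icc 0 T ×ˢ univ) := (isSmoothSpaceTimeOn_swirl (hsm.timeDerivWithin hU)).continuousOn
    have c2 : ContinuousOn (uncurry fun s x => swirl (u s) x) (Icc 0 T ×ˢ univ) := hw.continuousOn
    exact c1.mul c2
  have cF : ∀ n, ContinuousOn (fun s => ∫ x, φ n x *
      (swirl (FluidPDE.timeDerivWithin (Icc 0 T) u s) x * swirl (u s) x)) (Icc 0 T) := fun n =>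
    continuousOn_integral_mul_of_continuousOn
      (G := fun z => swirl (FluidPDE.timeDerivWithin (Icc 0 T) u z.1) z.2 * swirl (u z.1) z.2)
      (cφ n) (sφ n) hjoint
  have hident : ∀ n, ∫ s in Ioo 0 t, ∫ x, φ n x *
      (swirl (FluidPDE.timeDerivWithin (Icc 0 T) u s) x * swirl (u s) x) =
      2⁻¹ * (∫ x, φ n x * swirl (u t) x ^ 2) - 2⁻¹ * (∫ x, φ n x * swirl u₀ x ^ 2) := by
    intro n
    have hh := hw.integral_Ioo_integral_mul_timeDerivWithin_mul hT (cφ n) (sφ n) le_rfl ht.1 ht.2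
    rw [h.initial] at hh
    rw [← hh]
    refine setIntegral_congr_fun measurableSet_Ioo fun s hs => ?_
    refine integral_congr_ae (ae_of_all _ fun x => ?_)
    have hs' : s ∈ Icc 0 T := ⟨hs.1.le, hs.2.le.trans ht.2⟩
    simp only
    rw [hw' s hs' x]
  have hInt : ∀ n, ∫ s in Ioo 0 t, ∫ x, φ n x *
      (swirl (FluidPDE.timeDerivWithin (Icc 0 T) u s) x * swirl (u s) x) ≤
      K * ∫ s in Ioo 0 T, tail n s := by
    intro n
    have hsub : Ioo 0 t ⊆ Icc 0 T := fun s hs => ⟨hs.1.le, hs.2.le.trans ht.2⟩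
    have iF : IntegrableOn (fun s => ∫ x, φ n x *
        (swirl (FluidPDE.timeDerivWithin (Icc 0 T) u s) x * swirl (u s) x)) (Ioo 0 t) volume :=
      ((cF n).integrableOn_compact isCompact_Icc).mono_set hsub
    have iKt : IntegrableOn (fun s => K * tail n s) (Ioo 0 t) volume :=
      ((itail n).mono_set (Ioo_subset_Ioo le_rfl ht.2)).const_mul K
    have h1 := setIntegral_mono_on iF iKt measurableSet_Ioo fun s hs => hloc n s (hsub hs)
    have h2 : ∫ s in Ioo 0 t, K * tail n s = K * ∫ s in Ioo 0 t, tail n s := integral_const_mul _ _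
    have h3 : ∫ s in Ioo 0 t, tail n s ≤ ∫ s in Ioo 0 T, tail n s :=
      setIntegral_mono_set (itail n) ((ae_restrict_iff' measurableSet_Ioo).2
        (ae_of_all _ fun s _ => htail0 n s)) (Ioo_subset_Ioo le_rfl ht.2).eventuallyLE
    rw [h2] at h1
    exact h1.trans (mul_le_mul_of_nonneg_left h3 hK0)
  ------------------------------------------------------------------
  -- Step 4: the space–time tail tends to zero
  ------------------------------------------------------------------
  have hlim_tail : ∀ s ∈ Icc 0 T, Tendsto (fun n => tail n s) atTop (𝓝 0) := by
    intro s hs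
    have hlim := tendsto_integral_of_dominated_convergence (μ := volume) (fun x => ‖u s x‖ ^ 2)
      (F := fun n x => (1 - χ n x) * ‖u s x‖ ^ 2) (f := fun _ => (0 : ℝ))
      (fun n => (iτu n s hs).aestronglyMeasurable) (iu2 s hs)
      (fun n => ae_of_all _ fun x => by
        rw [Real.norm_eq_abs, abs_of_nonneg (mul_nonneg (by linarith [hχ1 n x]) (sq_nonneg _))]
        have := hχ0 n x; nlinarith [sq_nonneg ‖u s x‖])
      (ae_of_all _ fun x => by
        refine tendsto_const_nhds.congr' ((hχev x).mono fun n hn => ?_)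
        simp only [hn, sub_self, zero_mul])
    simpa [htail] using hlim
  have hlim_I : Tendsto (fun n => ∫ s in Ioo 0 T, tail n s) atTop (𝓝 0) := by
    have hlim := tendsto_integral_of_dominated_convergence (μ := volume.restrict (Ioo 0 T)) (fun _ => E)
      (F := fun n s => tail n s) (f := fun _ => (0 : ℝ))
      (fun n => ((ctail n).mono Ioo_subset_Icc_self).aestronglyMeasurable measurableSet_Ioo)
      (integrableOn_const (hs := measure_Ioo_lt_top.ne))
      (fun n => (ae_restrict_iff' measurableSet_Ioo).2 (ae_of_all _ fun s hs => by
        rw [Real.norm_eq_abs, abs_of_nonneg (htail0 n s)]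
        exact htailE n s (Ioo_subset_Icc_self hs)))
      ((ae_restrict_iff' measurableSet_Ioo).2 (ae_of_all _ fun s hs =>
        hlim_tail s (Ioo_subset_Icc_self hs)))
    simpa using hlim
  ------------------------------------------------------------------
  -- Step 5: `∫ φ_n Γ(t)² ≤ ∫ Γ₀² + 2K I_n`, then Fatou
  ------------------------------------------------------------------
  have hu0 : ContDiff ℝ ∞ u₀ := by rw [← h.initial]; exact hcl.contDiff_velocity ⟨le_rfl, hT.le⟩
  have cΓ0 : Continuous (swirl u₀) := (contDiff_swirl hu0).continuous
  have cΓt : Continuous (swirl (u t)) := (contDiff_swirl (hcl.contDiff_velocity ht)).continuous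
  have mΓ0 : MemLp (swirl u₀) 2 volume :=
    ⟨cΓ0.aestronglyMeasurable, eLpNorm_two_lt_top_of_lintegral_enorm_sq_lt_top hΓ0⟩
  have iΓ0 : Integrable (fun x => swirl u₀ x ^ 2) volume := mΓ0.integrable_sq
  have hstep : ∀ n, ∫ x, φ n x * swirl (u t) x ^ 2 ≤
      (∫ x, swirl u₀ x ^ 2) + 2 * K * ∫ s in Ioo 0 T, tail n s := by
    intro n
    have h1 := hident n
    have h2 := hInt n
    have h3 : ∫ x, φ n x * swirl u₀ x ^ 2 ≤ ∫ x, swirl u₀ x ^ 2 := by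
      refine integral_mono (iΓ0.bdd_mul (c := 1) (cφ n).aestronglyMeasurable (ae_of_all _ fun x => ?_))
        iΓ0 fun x => ?_
      · rw [Real.norm_eq_abs, abs_of_nonneg (hφ0 n x)]; exact hφ1 n x
      · have := hφ1 n x; have := hφ0 n x; nlinarith [sq_nonneg (swirl u₀ x)]
    linarith
  -- Fatou
  have inφ : ∀ n, Integrable (fun x => φ n x * swirl (u t) x ^ 2) volume := fun n =>
    ((cφ n).mul (cΓt.pow 2)).integrable_of_hasCompactSupport (sφ n).mul_right
  have hFn : ∀ n, ∫⁻ x, ENNReal.ofReal (φ n x * swirl (u t) x ^ 2) =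
      ENNReal.ofReal (∫ x, φ n x * swirl (u t) x ^ 2) := fun n =>
    (ofReal_integral_eq_lintegral_ofReal (inφ n) (ae_of_all _ fun x =>
      mul_nonneg (hφ0 n x) (sq_nonneg _))).symm
  have hlimx : ∀ x, Tendsto (fun n => ENNReal.ofReal (φ n x * swirl (u t) x ^ 2)) atTop
      (𝓝 (‖swirl (u t) x‖ₑ ^ 2)) := by
    intro x
    refine tendsto_const_nhds.congr' ((hφev x).mono fun n hn => ?_)
    beta_reduce
    rw [hn, one_mul, ← ofReal_norm, Real.norm_eq_abs, ← ENNReal.ofReal_pow (abs_nonneg _), sq_abs]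
  have hY : ENNReal.ofReal (∫ x, swirl u₀ x ^ 2) = ∫⁻ x, ‖swirl u₀ x‖ₑ ^ 2 := by
    rw [ofReal_integral_eq_lintegral_ofReal iΓ0 (ae_of_all _ fun x => sq_nonneg _)]
    exact lintegral_congr fun x => by
      rw [← ofReal_norm, Real.norm_eq_abs, ← ENNReal.ofReal_pow (abs_nonneg _), sq_abs]
  have hlimR : Tendsto (fun n => ENNReal.ofReal ((∫ x, swirl u₀ x ^ 2) + 2 * K * ∫ s in Ioo 0 T, tail n s))
      atTop (𝓝 (ENNReal.ofReal (∫ x, swirl u₀ x ^ 2))) := by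
    refine ENNReal.tendsto_ofReal ?_
    have := (hlim_I.const_mul (2 * K)).const_add (∫ x, swirl u₀ x ^ 2)
    simpa using this
  calc ∫⁻ x, ‖swirl (u t) x‖ₑ ^ 2
      = ∫⁻ x, liminf (fun n => ENNReal.ofReal (φ n x * swirl (u t) x ^ 2)) atTop :=
        lintegral_congr fun x => ((hlimx x).liminf_eq).symm
    _ ≤ liminf (fun n => ∫⁻ x, ENNReal.ofReal (φ n x * swirl (u t) x ^ 2)) atTop :=
        lintegral_liminf_le' fun n =>
          (((cφ n).mul (cΓt.pow 2)).measurable.ennreal_ofReal).aemeasurable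
    _ = liminf (fun n => ENNReal.ofReal (∫ x, φ n x * swirl (u t) x ^ 2)) atTop := by
        simp only [hFn]
    _ ≤ liminf (fun n => ENNReal.ofReal ((∫ x, swirl u₀ x ^ 2) + 2 * K * ∫ s in Ioo 0 T, tail n s)) atTop :=
        liminf_le_liminf (Eventually.of_forall fun n => ENNReal.ofReal_le_ofReal (hstep n))
    _ = ENNReal.ofReal (∫ x, swirl u₀ x ^ 2) := hlimR.liminf_eq
    _ = ∫⁻ x, ‖swirl u₀ x‖ₑ ^ 2 := hY

end IsTaoSolutionOn

end Literature.Analysis.FluidPDE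

end
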